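/- Copyright: cell `pub-balaban-gaps` (YM BLITZ Y1, track G2), seat ne6 = row NE7b, gen 6 — (A1c)-facing GENERIC supplier, file 2
(the averaging half), v2: RE-BASED on the tree's `Lit.….T4AveragingDisintegration` (lineage pv07, node U5b∕U5.E), whose
`jointLaw ∕ condLaw ∕ margDensity ∕ kernelTransport` v1 of this file had re-derived under other names (v1 withdrawn before filing).
Released under the licence of the surrounding project. -/
import Mathlib.Probability.Kernel.Composition.MeasureComp
import Mathlib.Probability.Kernel.WithDensity
import Literature.MathematicalPhysics.QuantumFieldTheory.Balaban1983to89.T4AveragingDisintegration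
import Literature.MathematicalPhysics.QuantumFieldTheory.Balaban1983to89.T4LimitDensity
import Summits.QuantumFields.BalabanUV.T4Continuum.Support.SubstrateFibredAveraging

/-!
# `T4Continuum.Spine.NE7b.StepKernelOfMap` — row NE7b, (α)-instance, (A1c)-facing, file 2 (v2): THE AVERAGING HALF OF A ONE-STEP
# OPERATION AS A KERNEL STEP — the tree's averaging kernel `condLaw ν avg` (`Lit.….T4AveragingDisintegration`) TWISTED by its marginal
# density `margDensity ν μ avg` satisfies file 1's measure identity `κ ∘ₘ μ = ν` (χ ≡ 1); on `SU(N)`, for Bałaban's block averaging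
# with the printed exp-mean-log small-loop average, UNCONDITIONALLY in the standing range (`avgStepKernel_comp_blockAvg_expMeanLogSU`)
# (cell `pub-balaban-gaps`, seat ne6 gen 6; record `HOME/ne/NE7b.md` §6 (10))

HONEST FRAMING.  Finite four-torus programme, rung (B)+1 only — NOT infinite volume, NOT a mass gap, NOT the Clay problem, NOT
summit progress, NOT a proof of NE7b (`Literature.….T4WeightBudget.RelWeightBound`, the cell's OWN estimate — NOT PRINTED in
[Bałaban 1983–89], NOT PROVED; INSTANCE 0∕1).  Nothing of Bałaban's is asserted, valued or discharged: [folklore] measure theory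
(Mathlib `Kernel.withDensity`, `Measure.bind`, `Measure.snd_compProd`) over the tree's CERTIFIED objects — `T4AveragingDisintegration`
(`jointLaw`, `condLaw`, `margDensity`, `withDensity_margDensity`, `fst_compProd_condLaw`, `kernelTransport`, `avgKernel`, `avgDensity`,
`standardBorelSpace_gaugeField ∕ _specialUnitaryGroup`), `T4FiniteEpsInhabited.HaarAC`, `BlockAveraging.measurable_avgFun`,
`BlockAveragingEMLFibreLawSUN.haarAC_avgFun_expMeanLogSU_SUN`, `T4LimitDensity.rnDeriv_le_of_le_smul`, and the substrate cell's
`Support/SubstrateFibredAveraging` (`FibredAveraging`, `fibreTransport`, `isProbabilityMeasure_μZ`, `map_Φ`) — all CONSUMED BY NAME, none restated.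
v3: the finiteness half of §2∕§3 follows chair X-SK23 leaf-06 g142's located objection π-SK23-1 and repair (R1) (truncation), adopted.  The block averaging (0.4) ∕
(0.11)–(0.12) of [Balaban1987RG1] pp. 253–254 and the δ-function form `(Tρ)(V) = ∫ dU δ(ŪV⁻¹) ρ(U)` enter only through those modules'
own citations and the cell's push-forward reading `Setup.IsRT` (DIVERGENCE F7).  WHICH averaging the NE7b tower's steps use, and the
identification of a tower step with «𝐑-term ∘ χ after 𝐓», are (A1c) DATA behind NEEDS-COORDINATOR NC-NE7b-α — NOT touched.  Spine
PROVED 0∕9 — unchanged.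

WHAT.
§1 (generic) `twist κ m := Kernel.withDensity κ (fun y _ => m y)` — a kernel scaled fibrewise by a density of its SOURCE level:
   `twist_apply` (`= m y • κ y`), `twist_apply'`, **`twist_univ`** (for a Markov `κ` the twisted fibre mass at `y` IS `m y` — the
   step's weight `T1 y`), `integral_twist` (`∫ f d(twist κ m y) = (m y).toReal·∫ f d(κ y)`), `twist_isFiniteKernel` (bounded `m`),
   **`twist_comp`** (`twist κ m ∘ₘ μ = κ ∘ₘ μ.withDensity m`).
§2 (generic map level, `T4AveragingDisintegration` §1's letters: coarse `α`, fine standard Borel `β`, `ν` on `β`, `μ` on `α`,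
   `avg : β → α`): **`condLaw_comp_map : condLaw ν avg ∘ₘ ν.map avg = ν`** (the disintegration `fst_compProd_condLaw` read through
   `Measure.snd_compProd`); **`mapStepKernel ν μ avg := twist (condLaw ν avg) (↑margDensity ν μ avg)`**; `integral_mapStepKernel`
   (its fibre integrals ARE the tree's `kernelTransport ν μ avg ρ` — so file 1's `(ofKernel (mapStepKernel …)).T` IS `kernelTransport`,
   pointwise); `mapStepKernel_univ` (weight = marginal density); **`mapStepKernel_comp : ν.map avg ≪ μ ⟹ mapStepKernel ν μ avg ∘ₘ μ
   = ν`** (`twist_comp` + `withDensity_margDensity` + `condLaw_comp_map`) = file 1's `hκ` with `χ ≡ 1`.  §2b FINITENESS (chair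
   X-SK23 leaf-06 g142's located objection π-SK23-1 + repair (R1), adopted with thanks): a POINTWISE bound on the Radon–Nikodym
   density is not dischargeable (it is pinned a.e. only); the dischargeable letter is the MEASURE INEQUALITY `ν.map avg ≤ C • μ`
   (`margDensity_le_ae`), and the TRUNCATED kernel **`truncStepKernel ν μ avg C := twist condLaw (min ↑margDensity C)`** is finite
   UNCONDITIONALLY (`truncStepKernel_isFinite`, an instance — what file 1's `ofKernel` over `bddMeas` consumes) with the SAME identity
   **`truncStepKernel_comp : Measurable avg → ν.map avg ≤ C • μ → truncStepKernel ν μ avg C ∘ₘ μ = ν`**.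
§3 (gauge fields, standard Borel `G`): `avgStepKernel avg := mapStepKernel (fieldMeasure P j G) (fieldMeasure P (j+1) G) avg`
   (= `twist (avgKernel avg) (↑avgDensity avg)`); **`avgStepKernel_comp : Measurable avg → HaarAC avg → avgStepKernel avg ∘ₘ
   fieldMeasure P (j+1) G = fieldMeasure P j G`**; `integral_avgStepKernel` (= `transportK avg ρ`, the tree's `RTOpI` transport);
   the finite `avgTruncStepKernel avg C` with **`avgTruncStepKernel_comp`** under `dU.map avg ≤ C • dV`.
§4 (`SU(N)`, standing range `j + 1 ≤ m + K`): **`avgStepKernel_comp_blockAvg_expMeanLogSU`** — for Bałaban's block averaging driven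
   by the printed exp-mean-log small-loop average on `SU(N)` the averaging step kernel satisfies the measure identity
   UNCONDITIONALLY (`measurable_avgFun` + `haarAC_avgFun_expMeanLogSU_SUN`, both in the tree).
§5 (a FIBRED averaging, the substrate cell's `Support/SubstrateFibredAveraging.FibredAveraging`: a measurable, Haar-compatible
   parametrisation `Φ : Z × 𝒰_{j+1} → 𝒰_j` of the fibres — the form the NE7b owner's roadmap `A1C-ROADMAP-g102.md` §3 (A1c-1) names):
   **`fibredStepKernel A`** (`V ↦ (μ_Z).map (z ↦ Φ (z, V))`, defined at EVERY `V`), **MARKOV** (`fibredStepKernel_isMarkov` — weight `T1 ≡ 1`,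
   so file 1's `ofKernel` needs NO finiteness hypothesis here), `integral_fibredStepKernel` (its fibre integrals ARE the substrate's
   `fibreTransport A ρ`), **`fibredStepKernel_comp : fibredStepKernel A ∘ₘ dV = dU` EXACTLY** (Fubini + `Φ_*(μ_Z ⊗ dV) = dU`).  That Bałaban's
   block averaging ADMITS a fibred structure is NOT asserted (the substrate's `FibredBlockAvg_stmt`, untyped); §3–§4 (disintegration +
   `HaarAC`) are the unconditional route on `SU(N)` today, §5 the hypothesis-free-weight route once a `FibredAveraging` is supplied.
NET for an (A1c) instance (with file 1 `StepKernelOps` and file 3 `StepKernelNormTerm`): the 𝐓-half of `op j g p` is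
`ofKernel (avgTruncStepKernel avg C)` under the letter `dU.map avg ≤ C • dV` (or `ofKernel (fibredStepKernel A)`, §5, with no
letter at all); composed with the 𝐑-term ∘ χ kernel (`comp_ofKernel_apply`, `Measure.comp_assoc`) the whole step is ONE kernel with
identity `χ·(fieldMeasure P j G)`.  HONEST LIMITS:
vacuous for NE7b alone; BY-NAME EFFECT ON THE WALL (`WALL-NE7b-P1.md` §2): NONE; NE7b NOT proved; count 0∕9.  HONEST DEPENDENCY (cell):
continuum YM on T⁴ ⇐ BetaPertH ∧ nine spine estimates (0∕9 proved); BetaPertH ⇐ (D1) ∧ (D4) ∧ CAP+tail; G-an2-4 gates asym, D1 and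
NE2∕3∕4.  This file changes none of it.
-/

open MeasureTheory ProbabilityTheory
open scoped ENNReal
open Literature.MathematicalPhysics.QuantumFieldTheory.Balaban1983to89
open Literature.MathematicalPhysics.QuantumFieldTheory.Balaban1983to89.T4AveragingDisintegration

namespace Summit.QuantumFields.BalabanUV.T4Continuum.Spine.NE7b.StepKernelOfMap

noncomputable section

/-! ## §1 The density twist of a kernel -/

section Twist

variable {X Y : Type*} [MeasurableSpace X] [MeasurableSpace Y]

/-- The kernel `κ` TWISTED by a density `m` of its source level: `(twist κ m) y = m y • κ y`. [folklore] -/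
def twist (κ : Kernel Y X) [IsSFiniteKernel κ] (m : Y → ℝ≥0∞) : Kernel Y X := Kernel.withDensity κ fun y _ => m y

variable (κ : Kernel Y X) [IsSFiniteKernel κ] {m : Y → ℝ≥0∞}

/-- Pointwise: `twist κ m y = m y • κ y` (for measurable `m`). [folklore] -/
theorem twist_apply (hm : Measurable m) (y : Y) : twist κ m y = m y • κ y := by
  have hu : Measurable (Function.uncurry fun (y : Y) (_ : X) => m y) := hm.comp measurable_fst
  rw [twist, Kernel.withDensity_apply _ hu, withDensity_const]

/-- The twisted kernel's fibre mass on a set: `m y * κ y s`. [folklore] -/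
theorem twist_apply' (hm : Measurable m) (y : Y) (s : Set X) : twist κ m y s = m y * κ y s := by
  rw [twist_apply κ hm]; rfl

/-- **THE WEIGHT IS THE DENSITY**: for a Markov `κ` the twisted kernel's total fibre mass at `y` is `m y`. [folklore] -/
theorem twist_univ [IsMarkovKernel κ] (hm : Measurable m) (y : Y) : twist κ m y Set.univ = m y := by
  rw [twist_apply' κ hm, measure_univ, mul_one]

/-- Integrals against the twisted fibre: `(m y).toReal · ∫ f d(κ y)`. [folklore] -/
theorem integral_twist (hm : Measurable m) (f : X → ℝ) (y : Y) :
    ∫ x, f x ∂(twist κ m y) = (m y).toReal * ∫ x, f x ∂(κ y) := by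
  rw [twist_apply κ hm, integral_smul_measure, smul_eq_mul]

/-- A bounded density twists a finite kernel into a finite kernel. [folklore] -/
theorem twist_isFiniteKernel [IsFiniteKernel κ] (hm : Measurable m) {C : ℝ≥0∞} (hC : C ≠ ⊤) (hmC : ∀ y, m y ≤ C) :
    IsFiniteKernel (twist κ m) := by
  refine ⟨⟨C * κ.bound, ENNReal.mul_lt_top hC.lt_top κ.bound_lt_top, fun y => ?_⟩⟩
  rw [twist_apply' κ hm]
  exact mul_le_mul' (hmC y) (κ.measure_le_bound y Set.univ)

/-- **THE TWIST MOVES THE DENSITY ACROSS THE COMPOSITION**: `twist κ m ∘ₘ μ = κ ∘ₘ (μ.withDensity m)`. [folklore] -/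
theorem twist_comp (hm : Measurable m) (μ : Measure Y) [SFinite μ] : twist κ m ∘ₘ μ = κ ∘ₘ μ.withDensity m := by
  ext s hs
  rw [Measure.bind_apply hs (Kernel.aemeasurable _), Measure.bind_apply hs (Kernel.aemeasurable _),
    lintegral_withDensity_eq_lintegral_mul _ hm (Kernel.measurable_coe κ hs)]
  refine lintegral_congr fun y => ?_
  rw [twist_apply' κ hm]
  rfl

end Twist

/-! ## §2 The averaging step kernel of a measurable map: `condLaw` twisted by `margDensity` -/

section Map

variable {α β : Type*} [MeasurableSpace α] [MeasurableSpace β]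

/-- The marginal density, coerced to `ℝ≥0∞`, is measurable. [folklore] -/
theorem measurable_margDensity_ennreal (ν : Measure β) (μ : Measure α) {avg : β → α} :
    Measurable fun V => (margDensity ν μ avg V : ℝ≥0∞) :=
  measurable_margDensity.coe_nnreal_ennreal

variable [StandardBorelSpace β] [Nonempty β] (ν : Measure β) [IsFiniteMeasure ν] (μ : Measure α) [SigmaFinite μ] {avg : β → α}

/-- **THE DISINTEGRATION AS ONE MEASURE IDENTITY**: composing the tree's conditional kernel `condLaw ν avg` with the image
measure returns `ν` — `∫ (∫ f d(condLaw V)) d(ν.map avg)(V) = ∫ f dν` for every integrable `f`. [folklore] -/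
theorem condLaw_comp_map (havg : Measurable avg) : condLaw ν avg ∘ₘ ν.map avg = ν := by
  calc condLaw ν avg ∘ₘ ν.map avg = ((jointLaw ν avg).fst ⊗ₘ condLaw ν avg).snd := by
        rw [Measure.snd_compProd, jointLaw_fst ν havg]
    _ = (jointLaw ν avg).snd := by rw [fst_compProd_condLaw ν avg]
    _ = ν := jointLaw_snd ν havg

/-- **THE AVERAGING STEP KERNEL** of the map `avg` (fine level `β`, measure `ν`; coarse level `α`, reference measure `μ`): the
conditional kernel twisted by the marginal density `d(avg_*ν)∕dμ`. [folklore] -/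
def mapStepKernel (ν : Measure β) [IsFiniteMeasure ν] (μ : Measure α) (avg : β → α) : Kernel α β :=
  twist (condLaw ν avg) fun V => (margDensity ν μ avg V : ℝ≥0∞)

omit [SigmaFinite μ] in
/-- **ITS FIBRE INTEGRALS ARE THE TREE's KERNEL TRANSPORT**: `∫ ρ d(mapStepKernel V) = kernelTransport ν μ avg ρ V` — so file 1's
`(StepKernelOps.ofKernel (mapStepKernel ν μ avg)).T ρ` IS `kernelTransport ν μ avg ρ`, pointwise. [folklore] -/
theorem integral_mapStepKernel (ρ : β → ℝ) (V : α) :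
    ∫ U, ρ U ∂(mapStepKernel ν μ avg V) = kernelTransport ν μ avg ρ V := by
  rw [mapStepKernel, integral_twist _ (measurable_margDensity_ennreal ν μ), ENNReal.coe_toReal]
  rfl

omit [SigmaFinite μ] in
/-- **THE WEIGHT IS THE MARGINAL DENSITY**: the step kernel's fibre mass at `V` is `margDensity ν μ avg V`. [folklore] -/
theorem mapStepKernel_univ (V : α) : mapStepKernel ν μ avg V Set.univ = margDensity ν μ avg V :=
  twist_univ _ (measurable_margDensity_ennreal ν μ) V

/-- **FILE 1's MEASURE IDENTITY FOR THE AVERAGING HALF**: under absolute continuity of the image measure (`HaarAC` on gauge fields)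
`mapStepKernel ν μ avg ∘ₘ μ = ν`. [folklore] -/
theorem mapStepKernel_comp (havg : Measurable avg) (hac : ν.map avg ≪ μ) : mapStepKernel ν μ avg ∘ₘ μ = ν := by
  rw [mapStepKernel, twist_comp _ (measurable_margDensity_ennreal ν μ) μ, withDensity_margDensity ν μ havg hac,
    condLaw_comp_map ν havg]

/-! ### §2b Finiteness (chair X-SK23 leaf-06 g142, located objection π-SK23-1 and repair (R1), kernel-checked in their probe
`J.sk23.probe.NOT-TO-FILE.lean` 9a134890c13f63c5): `margDensity` is a Radon–Nikodym derivative, pinned only ALMOST EVERYWHERE, so a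
POINTWISE bound on it is not dischargeable by any instance; what IS dischargeable is the measure inequality `ν.map avg ≤ C • μ`
(the averaging half's finiteness LETTER), which bounds the density a.e.; TRUNCATING the density at `C` gives an unconditionally
finite kernel with the SAME measure identity under that inequality. -/

omit [StandardBorelSpace β] [Nonempty β] [IsFiniteMeasure ν] in
/-- (π-SK23-1 (b1)) An a.e. bound on the marginal density from the measure inequality `ν.map avg ≤ C • μ` (the tree's
`T4LimitDensity.rnDeriv_le_of_le_smul`). [folklore] -/
theorem margDensity_le_ae (havg : Measurable avg) {C : NNReal} (hle : ν.map avg ≤ (C : ℝ≥0∞) • μ) :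
    ∀ᵐ V ∂μ, (margDensity ν μ avg V : ℝ≥0∞) ≤ C := by
  have h : (jointLaw ν avg).fst ≤ (C : ℝ≥0∞) • μ := by rwa [jointLaw_fst ν havg]
  filter_upwards [T4LimitDensity.rnDeriv_le_of_le_smul h] with V hV
  exact ENNReal.coe_toNNReal_le_self.trans hV

omit [StandardBorelSpace β] [Nonempty β] [IsFiniteMeasure ν] [SigmaFinite μ] in
/-- The truncated density `min (margDensity) C` is measurable. [folklore] -/
theorem measurable_truncDensity (C : NNReal) : Measurable fun V => min (margDensity ν μ avg V : ℝ≥0∞) C :=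
  (measurable_margDensity_ennreal ν μ).min measurable_const

/-- **THE TRUNCATED AVERAGING STEP KERNEL** ((R1) of π-SK23-1): `condLaw` twisted by `min (margDensity) C`. [folklore] -/
def truncStepKernel (ν : Measure β) [IsFiniteMeasure ν] (μ : Measure α) (avg : β → α) (C : NNReal) : Kernel α β :=
  twist (condLaw ν avg) fun V => min (margDensity ν μ avg V : ℝ≥0∞) C

omit [SigmaFinite μ] in
/-- **UNCONDITIONALLY FINITE** (mass letter `C`) — what file 1's `ofKernel` over `bddMeas` consumes as an instance. [folklore] -/
instance truncStepKernel_isFinite (C : NNReal) : IsFiniteKernel (truncStepKernel ν μ avg C) :=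
  twist_isFiniteKernel _ (measurable_truncDensity ν μ C) ENNReal.coe_ne_top fun _ => min_le_right _ _

omit [SigmaFinite μ] in
/-- Its weight at `V` is the truncated density `min (margDensity V) C`. [folklore] -/
theorem truncStepKernel_univ (C : NNReal) (V : α) :
    truncStepKernel ν μ avg C V Set.univ = min (margDensity ν μ avg V : ℝ≥0∞) C :=
  twist_univ _ (measurable_truncDensity ν μ C) V

/-- **THE ONE IDENTITY SURVIVES THE TRUNCATION** under the dischargeable hypothesis `ν.map avg ≤ C • μ` (a.e. the truncation is the
identity; `withDensity_congr_ae`). [folklore] -/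
theorem truncStepKernel_comp (havg : Measurable avg) {C : NNReal} (hle : ν.map avg ≤ (C : ℝ≥0∞) • μ) :
    truncStepKernel ν μ avg C ∘ₘ μ = ν := by
  have hac : ν.map avg ≪ μ := Measure.absolutelyContinuous_of_le_smul hle
  have hae : (fun V => min (margDensity ν μ avg V : ℝ≥0∞) C) =ᵐ[μ] fun V => (margDensity ν μ avg V : ℝ≥0∞) := by
    filter_upwards [margDensity_le_ae ν μ havg hle] with V hV
    exact min_eq_left hV
  rw [truncStepKernel, twist_comp _ (measurable_truncDensity ν μ C) μ, withDensity_congr_ae hae,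
    withDensity_margDensity ν μ havg hac, condLaw_comp_map ν havg]

end Map

/-! ## §3 Gauge fields: the averaging step kernel of one block averaging -/

section Gauge

open T4FiniteEpsInhabited

variable {P : Params} {j : ℕ} {G : Type*} [GaugeGroup G] [MeasurableSpace G] [HaarData G] [StandardBorelSpace G]

/-- **THE AVERAGING STEP KERNEL OF ONE BLOCK AVERAGING** `avg : GaugeField P j G → GaugeField P (j+1) G`: the tree's averaging
kernel `avgKernel avg` twisted by its marginal density `avgDensity avg`. [folklore] -/
def avgStepKernel (avg : GaugeField P j G → GaugeField P (j+1) G) : Kernel (GaugeField P (j+1) G) (GaugeField P j G) :=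
  mapStepKernel (fieldMeasure P j G) (fieldMeasure P (j+1) G) avg

/-- Its fibre integrals are the tree's one-step kernel transport `transportK avg ρ` (an `RTOpI` transport, `rtOpIOfKernel`). [folklore] -/
theorem integral_avgStepKernel (avg : GaugeField P j G → GaugeField P (j+1) G) (ρ : Density P j G) (V : GaugeField P (j+1) G) :
    ∫ U, ρ U ∂(avgStepKernel avg V) = transportK avg ρ V :=
  integral_mapStepKernel _ _ ρ V

/-- Its fibre mass is the marginal density `avgDensity avg V` (the free renormalization transformation's normalisation, read at
the kernel). [folklore] -/
theorem avgStepKernel_univ (avg : GaugeField P j G → GaugeField P (j+1) G) (V : GaugeField P (j+1) G) :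
    avgStepKernel avg V Set.univ = avgDensity avg V :=
  mapStepKernel_univ _ _ V

/-- **FILE 1's MEASURE IDENTITY (χ ≡ 1) FOR ONE BLOCK AVERAGING**: `avgStepKernel avg ∘ₘ dV = dU` for every measurable averaging with
`HaarAC`. [folklore] -/
theorem avgStepKernel_comp {avg : GaugeField P j G → GaugeField P (j+1) G} (havg : Measurable avg) (hac : HaarAC avg) :
    avgStepKernel avg ∘ₘ fieldMeasure P (j+1) G = fieldMeasure P j G :=
  mapStepKernel_comp _ _ havg ((haarAC_iff avg).1 hac)

/-- **THE TRUNCATED (FINITE) AVERAGING STEP KERNEL OF ONE BLOCK AVERAGING**, mass letter `C`. [folklore] -/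
def avgTruncStepKernel (avg : GaugeField P j G → GaugeField P (j+1) G) (C : NNReal) :
    Kernel (GaugeField P (j+1) G) (GaugeField P j G) :=
  truncStepKernel (fieldMeasure P j G) (fieldMeasure P (j+1) G) avg C

/-- It is finite, unconditionally. [folklore] -/
instance avgTruncStepKernel_isFinite (avg : GaugeField P j G → GaugeField P (j+1) G) (C : NNReal) :
    IsFiniteKernel (avgTruncStepKernel avg C) := by
  unfold avgTruncStepKernel; infer_instance

/-- **FILE 1's MEASURE IDENTITY FOR THE FINITE 𝐓-STEP** under the averaging half's finiteness letter — the MEASURE INEQUALITY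
`dU.map avg ≤ C • dV` (a strengthening of `HaarAC` that an (A1c) instance owes for finiteness; NOT in the tree for Bałaban's
block averaging today). [folklore] -/
theorem avgTruncStepKernel_comp {avg : GaugeField P j G → GaugeField P (j+1) G} (havg : Measurable avg) {C : NNReal}
    (hle : (fieldMeasure P j G).map avg ≤ (C : ℝ≥0∞) • fieldMeasure P (j+1) G) :
    avgTruncStepKernel avg C ∘ₘ fieldMeasure P (j+1) G = fieldMeasure P j G :=
  truncStepKernel_comp _ _ havg hle

end Gauge

/-! ## §4 `SU(N)`: Bałaban's block averaging with the printed exp-mean-log small-loop average — unconditional -/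

section SUN

open T4FiniteEpsInhabited BlockAveraging ExpMeanLog BlockAveragingEMLFibreLawSUN

variable {N : ℕ} [NeZero N] {P : Params} {j : ℕ}

/-- **ON `SU(N)`, STANDING RANGE**: the averaging step kernel of Bałaban's block averaging (0.4) driven by the printed exp-mean-log
small-loop average satisfies file 1's measure identity UNCONDITIONALLY — measurability (`measurable_avgFun`) and `HaarAC`
(`haarAC_avgFun_expMeanLogSU_SUN`) are the tree's.  (The FINITE variant `avgTruncStepKernel_comp` stays CONDITIONAL on the measure
inequality `dU.map avg ≤ C • dV`, which the tree does not hold for this averaging — `HaarAC` is absolute continuity only.) [folklore] -/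
theorem avgStepKernel_comp_blockAvg_expMeanLogSU (hj : j + 1 ≤ P.m + P.K) :
    avgStepKernel (avgFun (expMeanLogSU : LoopAverage (Matrix.specialUnitaryGroup (Fin N) ℂ)))
        ∘ₘ fieldMeasure P (j+1) (Matrix.specialUnitaryGroup (Fin N) ℂ) =
      fieldMeasure P j (Matrix.specialUnitaryGroup (Fin N) ℂ) :=
  avgStepKernel_comp (measurable_avgFun _ measurable_expMeanLogSU_E) (haarAC_avgFun_expMeanLogSU_SUN hj)

end SUN

/-! ## §5 A FIBRED averaging (`Support/SubstrateFibredAveraging`): the step kernel is MARKOV, its identity EXACT, its weight `1` -/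

section Fibred

open Summit.QuantumFields.BalabanUV.T4Continuum.SubstrateFibredAveraging

variable {P : Params} {j : ℕ} {G : Type*} [GaugeGroup G] [MeasurableSpace G] [HaarData G]
  {avg : GaugeField P j G → GaugeField P (j+1) G}

/-- The fibre map at a coarse field, `z ↦ Φ (z, V)`, is measurable. [folklore] -/
theorem measurable_fibreMap (A : FibredAveraging P j G avg) (V : GaugeField P (j+1) G) : Measurable fun z => A.Φ (z, V) :=
  A.measurable_Φ.comp (measurable_id.prodMk measurable_const)

/-- **THE FIBRED STEP KERNEL** of a fibred averaging (the substrate cell's `FibredAveraging`: a measurable, Haar-compatible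
parametrisation `Φ : Z × 𝒰_{j+1} → 𝒰_j` of the fibres): `V ↦ (μ_Z).map (z ↦ Φ (z, V))` — the law of the fine field given the coarse one,
defined at EVERY `V`. [folklore] -/
def fibredStepKernel (A : FibredAveraging P j G avg) : Kernel (GaugeField P (j+1) G) (GaugeField P j G) where
  toFun V := A.μZ.map fun z => A.Φ (z, V)
  measurable' := by
    refine Measure.measurable_of_measurable_coe _ fun s hs => ?_
    simp_rw [Measure.map_apply (measurable_fibreMap A _) hs]
    exact measurable_measure_prodMk_right (A.measurable_Φ hs)

/-- The fibred step kernel at `V`. [folklore] -/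
theorem fibredStepKernel_apply (A : FibredAveraging P j G avg) (V : GaugeField P (j+1) G) :
    fibredStepKernel A V = A.μZ.map fun z => A.Φ (z, V) := rfl

/-- **IT IS MARKOV** (the fluctuation measure is a probability measure, `isProbabilityMeasure_μZ`) — so its weight `T1 ≡ 1` and file 1's
`ofKernel` needs no finiteness hypothesis. [folklore] -/
instance fibredStepKernel_isMarkov (A : FibredAveraging P j G avg) : IsMarkovKernel (fibredStepKernel A) := by
  haveI := isProbabilityMeasure_μZ A
  exact ⟨fun V => by rw [fibredStepKernel_apply]; exact Measure.isProbabilityMeasure_map (measurable_fibreMap A V).aemeasurable⟩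

/-- **ITS FIBRE INTEGRALS ARE THE SUBSTRATE's FIBRE TRANSPORT** (for measurable `ρ`): `∫ ρ d(fibredStepKernel A V) = fibreTransport A ρ V`
— so `(StepKernelOps.ofKernel (fibredStepKernel A)).T ρ = fibreTransport A ρ` on the class. [folklore] -/
theorem integral_fibredStepKernel (A : FibredAveraging P j G avg) {ρ : Density P j G} (hρ : Measurable ρ) (V : GaugeField P (j+1) G) :
    ∫ U, ρ U ∂(fibredStepKernel A V) = fibreTransport A ρ V := by
  rw [fibredStepKernel_apply, integral_map (measurable_fibreMap A V).aemeasurable hρ.aestronglyMeasurable]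
  rfl

/-- **FILE 1's MEASURE IDENTITY, EXACT**: `fibredStepKernel A ∘ₘ dV = dU` (Fubini `Measure.prod_apply_symm` + the Haar compatibility
`Φ_*(μ_Z ⊗ dV) = dU` of the fibred structure). [folklore] -/
theorem fibredStepKernel_comp (A : FibredAveraging P j G avg) :
    fibredStepKernel A ∘ₘ fieldMeasure P (j+1) G = fieldMeasure P j G := by
  ext s hs
  rw [Measure.bind_apply hs (Kernel.aemeasurable _)]
  simp_rw [fibredStepKernel_apply, Measure.map_apply (measurable_fibreMap A _) hs]
  have e : (fun a => A.μZ ((fun z => A.Φ (z, a)) ⁻¹' s)) = fun a => A.μZ ((fun x => (x, a)) ⁻¹' (A.Φ ⁻¹' s)) := rfl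
  rw [e, ← Measure.prod_apply_symm (A.measurable_Φ hs), ← Measure.map_apply A.measurable_Φ hs, A.map_Φ]

end Fibred

end

end Summit.QuantumFields.BalabanUV.T4Continuum.Spine.NE7b.StepKernelOfMap
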